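import Literature.NumberTheory.GaloisRepresentations.LubinTateTowerGenerator
import Literature.NumberTheory.GaloisRepresentations.LubinTateComparisonPoints
import HarnessLib

/-!
# The coherent `π`-division tower of the Lubin–Tate group inside `𝔪_{ℂ_F}`

Topic `Literature/NumberTheory/GaloisRepresentations`; one DEFINITION (`toCPt`, with the tower `ltDivTower`) and
THEOREMS. The tree has the coherent generator `ω_{n+1} = cohPt hπ n ∈ 𝔪_{K_π^{n+1}}` of the Tate module of the
Lubin–Tate group `F_f`, `f = πX + X^q` (`LubinTateTowerGenerator`: `[π]_f ω_{n+2} = ω_{n+1}`), the embedding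
`𝒪_E → 𝒪_{ℂ_F}` of a finite subextension `E ⊆ F̄` (`unitBallToCBall`, `LubinTateComparisonPoints`) and the
series `[a]_f` read on `𝒪_{ℂ_F}` (`homC hπ a`). This file pushes the tower into `ℂ_F`:

* `toCPt E x ∈ 𝔪_ℂ` — a point `x ∈ 𝔪_E` read in `𝔪_{ℂ_F}`; `toCPt_inclPt`; ★ `toCPt_ltAct : toCPt([a]_f x) =
  [a]_f(toCPt x)` (the action computed in `K_π^{n+1}` and in `ℂ_F` agree — `unitBallToCBall_evalPt₁`);
* `ltDivTower hπ : ℕ → 𝔪_ℂ`, `t₀ = 0`, `t_{n+1} = ω_{n+1}`: **`[π]_f t_{n+1} = t_n`** (`evalPt₁_homC_ltDivTower_succ`,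
  and in closed form `π·t_{n+1} + t_{n+1}^q = t_n`, `ltPoly_ltDivTower_succ`), **`t₁ ≠ 0`** (`ltDivTower_one_ne_zero`);
* ★ **`σ(t_n) = [χ_π(σ)]_f(t_n)`** for every `σ ∈ Γ_F` (`galCBall_ltDivTower`, from the tree's
  `absGal_smul_ltAct_lubinTateChar`): the tower is a `χ_π`-eigen-division-tower in `𝔪_{ℂ_F}` — the input of
  Fontaine's element `x_t ∈ A_inf` and of the Lubin–Tate period `t_LT ∈ B_dR⁺` (sequel, topic `PAdicHodge`).

## References
* E. de Shalit, *Iwasawa theory of elliptic curves with complex multiplication* (1987), Ch. I §2.2. [deShalit1987]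
* J. W. S. Cassels, A. Fröhlich (eds.), *Algebraic Number Theory* (1967), Ch. VI §3.4 Thm. 3, §3.6 Prop. 6. [CasselsFrohlichANT1967]
* P. Colmez, *Périodes des variétés abéliennes à multiplication complexe*, Ann. of Math. 138 (1993), §I.2. [Colmez1993]
-/

noncomputable section

open MvPowerSeries

namespace Literature.NumberTheory.GaloisRepresentations

section Tower

open ValuativeRel IsLocalRing Field IsNonarchimedeanLocalField LubinTate
open Literature.NumberTheory.PAdicHodge

variable {F : Type} [Field F] [ValuativeRel F] [TopologicalSpace F] [IsNonarchimedeanLocalField F]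

-- the normed-field instances on `F` and on finite subextensions of `F̄` of `LubinTateTorsion.lean`
attribute [local instance] instUniformSpace_literature rk1 nF nE

/-- (local) the uniform structure of `F` is a group uniformity. [folklore] -/
local instance towerIsUniformAddGroup : IsUniformAddGroup F := isUniformAddGroup_of_addCommGroup

/-! ## §1 Points of `𝔪_E` read in `𝔪_{ℂ_F}` -/

section ToC

variable (E : IntermediateField F (AlgebraicClosure F)) [FiniteDimensional F E]

/-- **A point `x ∈ 𝔪_E` read in `𝔪_{ℂ_F}`** (along `𝒪_E → 𝒪_{ℂ_F}`). [cite: deShalit1987, Ch. I §2.2] -/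
def toCPt (x : (maxNilIdeal F E).toIdeal) : (maxNilIdealC F).toIdeal :=
  ⟨unitBallToCBall E (x : unitBall E), unitBallToCBall_mem E x.2⟩

/-- Unfolding `toCPt` in `𝒪_{ℂ_F}`. [cite: deShalit1987, Ch. I §2.2] -/
@[simp] theorem coe_toCPt (x : (maxNilIdeal F E).toIdeal) :
    ((toCPt E x : (maxNilIdealC F).toIdeal) : CBall F) = unitBallToCBall E (x : unitBall E) := rfl

/-- Unfolding `toCPt` in `ℂ_F`: `x ∈ E ⊆ F̄ ⊆ ℂ_F`. [cite: deShalit1987, Ch. I §2.2] -/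
theorem coe_coe_toCPt (x : (maxNilIdeal F E).toIdeal) :
    (((toCPt E x : (maxNilIdealC F).toIdeal) : CBall F) : CompletedAlgClosure F) =
      algClosureToC F (((x : unitBall E) : E) : AlgebraicClosure F) := rfl

omit [FiniteDimensional F E] in
/-- `toCPt` is compatible with the inclusions `E₁ ⊆ E₂`. [cite: deShalit1987, Ch. I §2.2] -/
theorem toCPt_inclPt {E₁ E₂ : IntermediateField F (AlgebraicClosure F)} [FiniteDimensional F E₁] [FiniteDimensional F E₂]
    (h : E₁ ≤ E₂) (x : (maxNilIdeal F E₁).toIdeal) : toCPt E₂ (inclPt h x) = toCPt E₁ x :=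
  Subtype.ext (Subtype.ext rfl)

/-- `toCPt` is injective (`F̄ → ℂ_F` is). [cite: deShalit1987, Ch. I §2.2] -/
theorem toCPt_injective : Function.Injective (toCPt (F := F) E) := fun x y h => by
  have h1 := congrArg (fun z : (maxNilIdealC F).toIdeal => ((z : CBall F) : CompletedAlgClosure F)) h
  simp only [coe_coe_toCPt] at h1
  exact Subtype.ext (Subtype.ext (Subtype.ext ((algClosureToC F).injective h1)))

end ToC

variable {π : 𝒪[F]} (hπ : (valuation F).IsUniformizer (π : F))

/-- ★ **`[a]_f` computed in `K_π^{n+1}` and in `ℂ_F` agree**: `toCPt([a]_f x) = [a]_f(toCPt x)` (`homC hπ a` is `[a]_f`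
read on `𝒪̂_{F^nr} → 𝒪_{ℂ_F}`). [cite: CasselsFrohlichANT1967, Ch. VI §3.4] -/
theorem toCPt_ltAct (n : ℕ) (a : 𝒪[F]) (x : (maxNilIdeal F (ltField π n)).toIdeal) :
    toCPt (ltField π n) (ltAct hπ n a x) =
      evalPt₁ (maxNilIdealC F) (homC hπ a) (constantCoeff_homC hπ a) (toCPt (ltField π n) x) := by
  have h := unitBallToCBall_evalPt₁ (ltField π n)
    (hom (isLTRing_integer F hπ) (isLTSeries_ltPoly F) (isLTSeries_ltPoly F) a) (constantCoeff_hom _ _ _ a) x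
  apply Subtype.ext
  refine Eq.trans ?_ h
  rw [coe_toCPt]
  congr 2

/-! ## §2 The tower `t₀ = 0`, `t_{n+1} = ω_{n+1}` in `𝔪_{ℂ_F}` -/

/-- **The coherent `π`-division tower of `F_f` in `𝔪_{ℂ_F}`**: `t₀ = 0`, `t_{n+1} = ω_{n+1} = cohPt hπ n`.
[cite: deShalit1987, Ch. I §2.2] -/
def ltDivTower : ℕ → (maxNilIdealC F).toIdeal
  | 0 => 0
  | n + 1 => toCPt (ltField π n) (cohPt hπ n)

/-- `t₀ = 0`. [cite: deShalit1987, Ch. I §2.2] -/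
@[simp] theorem ltDivTower_zero : ltDivTower hπ 0 = 0 := rfl

/-- `t_{n+1} = ω_{n+1}`. [cite: deShalit1987, Ch. I §2.2] -/
theorem ltDivTower_succ (n : ℕ) : ltDivTower hπ (n + 1) = toCPt (ltField π n) (cohPt hπ n) := rfl

/-- `t₀ = 0` in `𝒪_{ℂ_F}`. [cite: deShalit1987, Ch. I §2.2] -/
theorem coe_ltDivTower_zero : ((ltDivTower hπ 0 : (maxNilIdealC F).toIdeal) : CBall F) = 0 := rfl

/-- **`t₁ ≠ 0`** (`ω₁ = f^{(0)}(ω₁) ≠ 0`, a primitive point of level `1`). [cite: deShalit1987, Ch. I §2.2] -/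
theorem ltDivTower_one_ne_zero : ((ltDivTower hπ 1 : (maxNilIdealC F).toIdeal) : CBall F) ≠ 0 := by
  intro h
  have h1 := aeval_cohPt_ltPolyIter_ne_zero hπ 0
  rw [ltPolyIter, Polynomial.map_X, Polynomial.aeval_X] at h1
  have h2 : (((ltDivTower hπ 1 : (maxNilIdealC F).toIdeal) : CBall F) : CompletedAlgClosure F) = 0 := by
    rw [h]; rfl
  rw [ltDivTower_succ, coe_coe_toCPt, map_eq_zero_iff _ (algClosureToC F).injective] at h2
  exact h1 (by exact_mod_cast h2)

/-- **`[π]_f t_{n+1} = t_n`** (`[π]_f ω_{n+2} = ω_{n+1}`, `[π]_f ω₁ = 0`). [cite: deShalit1987, Ch. I §2.2] -/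
theorem evalPt₁_homC_ltDivTower_succ (n : ℕ) :
    evalPt₁ (maxNilIdealC F) (homC hπ π) (constantCoeff_homC hπ π) (ltDivTower hπ (n + 1)) = ltDivTower hπ n := by
  cases n with
  | zero =>
    have e : ltAct hπ 0 (π * (cohUnit hπ 0 : 𝒪[F])) (genPt hπ 0) = 0 := by
      have h := ltAct_pow_mul_genPt hπ 0 (cohUnit hπ 0 : 𝒪[F])
      rwa [zero_add, pow_one] at h
    rw [ltDivTower_succ, ← toCPt_ltAct, cohPt_eq, ← ltAct_mul, e]
    exact Subtype.ext (map_zero _)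
  | succ n =>
    rw [ltDivTower_succ, ← toCPt_ltAct, ltAct_pi_cohPt_succ, toCPt_inclPt, ltDivTower_succ]

/-- `[π]_f t_{n+1} = t_n` in closed form: **`π·t_{n+1} + t_{n+1}^q = t_n` in `ℂ_F`.** [cite: deShalit1987, Ch. I §2.2] -/
theorem ltPoly_ltDivTower_succ (n : ℕ) :
    algebraMap F (CompletedAlgClosure F) (π : F) * ((ltDivTower hπ (n + 1) : (maxNilIdealC F).toIdeal) : CBall F) +
        (((ltDivTower hπ (n + 1) : (maxNilIdealC F).toIdeal) : CBall F) : CompletedAlgClosure F) ^ residueFieldCard F =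
      ((ltDivTower hπ n : (maxNilIdealC F).toIdeal) : CBall F) := by
  have h := congrArg (fun z : (maxNilIdealC F).toIdeal => ((z : CBall F) : CompletedAlgClosure F))
    (evalPt₁_homC_ltDivTower_succ hπ n)
  have h1 : evalPt₁ (maxNilIdealC F) (homC hπ π) (constantCoeff_homC hπ π) (ltDivTower hπ (n + 1)) =
      evalPt₁ (maxNilIdealC F) (homC hπ (π ^ 1)) (constantCoeff_homC hπ _) (ltDivTower hπ (n + 1)) :=
    evalPt_congr (maxNilIdealC F) (by rw [pow_one]) _ _ _
  rw [← h, h1, coe_evalPt₁_homC_pow, ltPolyIter_one, ltPoly, Polynomial.map_add, Polynomial.map_mul,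
    Polynomial.map_pow, Polynomial.map_C, Polynomial.map_X, map_add, map_mul, map_pow, Polynomial.aeval_C,
    Polynomial.aeval_X]
  rfl

/-! ## §3 `σ(t_n) = [χ_π(σ)]_f(t_n)` -/

/-- ★ **The tower is a `χ_π`-eigen-tower: `σ(t_n) = [χ_π(σ)]_f(t_n)`** for every `σ ∈ Γ_F` and every `n`
(`σ ω_{n+1} = [χ_π(σ)]_f ω_{n+1}`, the defining property of the Lubin–Tate character, read in `ℂ_F`).
[cite: CasselsFrohlichANT1967, Ch. VI §3.4 Thm. 3 (b)] [cite: Colmez1993, §I.2] -/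
theorem galCBall_ltDivTower (σ : absoluteGaloisGroup F) (n : ℕ) :
    galCBall σ ((ltDivTower hπ n : (maxNilIdealC F).toIdeal) : CBall F) =
      (evalPt₁ (maxNilIdealC F) (homC hπ (lubinTateChar hπ σ : 𝒪[F])) (constantCoeff_homC hπ _) (ltDivTower hπ n) :
        CBall F) := by
  cases n with
  | zero => rw [ltDivTower_zero, evalPt₁_zero]; exact map_zero _
  | succ n =>
    rw [ltDivTower_succ, ← toCPt_ltAct]
    apply Subtype.ext
    rw [coe_galCBall, coe_toCPt, coe_toCPt, coe_unitBallToCBall, coe_unitBallToCBall, smul_algClosureToC, cohPt_eq,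
      absGal_smul_ltAct_lubinTateChar, ltAct_mul]

/-- Pointed form: **`σ • t_n = [χ_π(σ)]_f(t_n)` as points of `𝔪_{ℂ_F}`.** [cite: CasselsFrohlichANT1967, Ch. VI §3.4 Thm. 3 (b)] -/
theorem galCBall_ltDivTower_pt (σ : absoluteGaloisGroup F) (n : ℕ) :
    (⟨galCBall σ ((ltDivTower hπ n : (maxNilIdealC F).toIdeal) : CBall F), galCBall_mem (ltDivTower hπ n).2⟩ :
        (maxNilIdealC F).toIdeal) =
      evalPt₁ (maxNilIdealC F) (homC hπ (lubinTateChar hπ σ : 𝒪[F])) (constantCoeff_homC hπ _) (ltDivTower hπ n) :=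
  Subtype.ext (galCBall_ltDivTower hπ σ n)

end Tower

end Literature.NumberTheory.GaloisRepresentations

end
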